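import Mathlib
import Literature.Analysis.OperatorTheory.ContractiveDeterminantalRepresentation
import Literature.Analysis.OperatorTheory.ContractiveDeterminantalRepresentationProofs
import Literature.Analysis.OperatorTheory.ContractiveDetReflectionIdentity
import Summits.ValiantsHypothesis.ValiantsHypothesis.Theorems.ContractivityPriceContractiveHardnessNonSurjective

/-!
# Stub `stub_dvdForcesSurjective` of crux `ContractivityPrice.ContractiveHardness`
# (line `registered` = BC3 birth skeleton `Cruxes/ContractiveHardness/Lines/birth.lean`, reshape 3)

Variable counting: if the stabilised permanent `Q_n = per_n(I + z/(4n))` divides a pencil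
determinant `det(I − D Z_{κ'})` (`gkvwDet κ' D`, any square `D`), then the block structure
`κ' : Fin R' → [n]²` is SURJECTIVE (so `R' ≥ n²`).  Indeed `det(I − D Z_{κ'})` has constant term
`1`, hence is non-zero (`gkvwDet_ne_zero`); over `ℂ` a divisor of a non-zero polynomial only
involves variables of that polynomial (`vars_subset_vars_of_dvd`); the pencil determinant only
involves the variables `z_{κ'(i)}` (`mem_range_of_mem_vars_gkvwDet`); and every variable `z_e`
occurs in `Q_n` (`mem_vars_stabPer`).

Contents: the registered stub `stub_dvdForcesSurjective` (the hypothesis `1 ≤ n` of the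
registered signature is not needed by the proof).
-/

noncomputable section

namespace Summit.ValiantsHypothesis.ValiantsHypothesis.Theorems

open MvPolynomial Matrix Literature.Analysis.OperatorTheory
open Literature.Computability.AlgebraicComplexity

set_option linter.dupNamespace false

/-- **Registered stub `stub_dvdForcesSurjective`** (line `registered`/birth of crux
`ContractivityPrice.ContractiveHardness`, reshape 3): if `Q_n = per_n(I + z/(4n))` divides the
pencil determinant `det(I − D Z_{κ'})`, then `κ'` reads every variable `e ∈ [n]²`: `e` occurs in
`Q_n`, hence (a divisor of the non-zero polynomial `det(I − D Z_{κ'})`) in `det(I − D Z_{κ'})`,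
whose variables all lie in the range of `κ'`. [folklore] -/
theorem stub_dvdForcesSurjective :
    ∀ n : ℕ, 1 ≤ n → ∀ (R' : ℕ) (κ' : Fin R' → Fin n × Fin n) (D : Matrix (Fin R') (Fin R') ℂ),
      (MvPolynomial.aeval (fun e : Fin n × Fin n =>
            MvPolynomial.C (if e.1 = e.2 then (1 : ℂ) else 0) +
              MvPolynomial.C ((4 * (n : ℂ))⁻¹) * MvPolynomial.X e)
          (Literature.Computability.AlgebraicComplexity.perPoly (Fin n) ℂ)) ∣ gkvwDet κ' D →
      Function.Surjective κ' := by
  intro n _ R' κ' D hdvd e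
  exact mem_range_of_mem_vars_gkvwDet κ' D
    (vars_subset_vars_of_dvd hdvd (gkvwDet_ne_zero κ' D) (mem_vars_stabPer e))

end Summit.ValiantsHypothesis.ValiantsHypothesis.Theorems

end
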